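import Literature.NumberTheory.Automorphic.UnitaryGroupDoubledSiegelGeneration
import HarnessLib

/-!
# The Siegel parabolic of the doubled unitary group over a commutative RING: Cayley basis, Levi factor, unipotent radical

Topic `NumberTheory/Automorphic`; namespace `Literature.NumberTheory.Automorphic.DoubledUnitary` (sequel of
`UnitaryGroupDoubledSiegelGeneration`, whose `cayley` ∕ `upperUnipotent` ∕ (in `…SiegelBruhat`) `leviUpper` are typed over
a FIELD `K`).  KERNEL only: proved theorems, no definition, no named fact, no `sorry`.

Setting ([Kudla1994, §3]; [HarrisKudlaSweet1996, §1 (1.9)–(1.12)]): `R` a commutative ring with a ring endomorphism `σ`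
(an involution where said), the doubled form `S ⊕ (−S)` and its Cayley transform.  Everything here is the ring-level
version of the field-level dictionary of `UnitaryGroupDoubledSiegelGeneration` §3, needed for the ARCHIMEDEAN points
`U(J^𝔻)(L⁺ ⊗ ℝ) = U(σ, J^𝔻 ⊗ 1)` over the product ring `L ⊗ ℝ ≅ ∏_w ℂ` (not a field):

* `cayleyMat_mul_mul_cayleyMat`, `cayleyMat_mul_self`, `formCongr_cayleyMat` — `C = [[1,1],[1,−1]]`, `C² = 2`,
  `σ(C)ᵀ (S ⊕ −S) C = antidiag(S + S, S + S)`;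
* `exists_unipotent` — the unipotent elements `n(z) = [[1, z],[0, 1]]` (as a map `Matrix ι ι R → GL_{ι ⊕ ι}(R)`, additive to
  multiplicative) and the membership criterion `n(z) ∈ U(σ, antidiag(τ, τ)) ↔ τ z + σ(z)ᵀ τ = 0`;
* `exists_leviHom` — for `σ` an involution and `τ` symmetric, `σ`-fixed with unit determinant, the Levi HOMOMORPHISM
  `m : GL_ι(R) →* GL_{ι ⊕ ι}(R)`, `m(α) = diag(α, τ⁻¹ σ(α⁻¹)ᵀ τ)`, with values in `U(σ, antidiag(τ, τ))`.

Stated as existentials over maps (no new definitions).  Consumer: `UnitaryGroupDoubledSiegelSquares` (every element of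
`P_Δ` is a product of squares of elements of `P_Δ` when `GL_ι(R)` is generated by squares — input U3 of the archimedean
half `stub_S1arch` of the kernel construction of [GelbartRogawski1991, Prop. 3.1.1], stage-1 cell `pub-hodgecm`).

## References

* S. S. Kudla, *Splitting metaplectic covers of dual reductive pairs*, Israel J. Math. 87 (1994), §3 [Kudla1994].
* M. Harris, S. S. Kudla, W. J. Sweet, *Theta dichotomy for unitary groups*, J. Amer. Math. Soc. 9 (1996), §1
  (1.9)–(1.12) [HarrisKudlaSweet1996].
-/

set_option autoImplicit false

open Matrix

namespace Literature.NumberTheory.Automorphic.DoubledUnitary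

variable {R : Type*} [CommRing R] {ι : Type*} [Fintype ι] [DecidableEq ι] (σ : R →+* R)

/-! ### block helpers over a commutative ring -/

/-- `C M C` for the Cayley matrix `C = [[1,1],[1,−1]]` (columns: the `(Δ, Δ⁻)`-adapted basis), blockwise over any
commutative ring. [cite: HarrisKudlaSweet1996, §1 (1.11)] -/
theorem cayleyMat_mul_mul_cayleyMat (a b c d : Matrix ι ι R) :
    Matrix.fromBlocks (1 : Matrix ι ι R) (1 : Matrix ι ι R) (1 : Matrix ι ι R) (-1 : Matrix ι ι R) *
        Matrix.fromBlocks a b c d *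
        Matrix.fromBlocks (1 : Matrix ι ι R) (1 : Matrix ι ι R) (1 : Matrix ι ι R) (-1 : Matrix ι ι R) =
      Matrix.fromBlocks (a + c + (b + d)) (a + c - (b + d)) (a - c + (b - d)) (a - c - (b - d)) := by
  simp only [Matrix.fromBlocks_multiply, Matrix.one_mul, Matrix.mul_one, Matrix.neg_mul, Matrix.mul_neg,
    Matrix.mul_one]
  congr 1 <;> abel

/-- `C C = 2 · 1`: `C` is invertible as soon as `2` is (inverse `½ C`). [cite: HarrisKudlaSweet1996, §1 (1.11)] -/
theorem cayleyMat_mul_self :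
    Matrix.fromBlocks (1 : Matrix ι ι R) (1 : Matrix ι ι R) (1 : Matrix ι ι R) (-1 : Matrix ι ι R) *
        Matrix.fromBlocks (1 : Matrix ι ι R) (1 : Matrix ι ι R) (1 : Matrix ι ι R) (-1 : Matrix ι ι R) =
      (2 : R) • (1 : Matrix (ι ⊕ ι) (ι ⊕ ι) R) := by
  rw [← Matrix.fromBlocks_one, Matrix.fromBlocks_smul, Matrix.fromBlocks_multiply]
  simp only [Matrix.mul_one, Matrix.mul_neg, neg_neg, smul_zero, add_neg_cancel, two_smul]

omit [Fintype ι] in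
/-- `σ` applied entrywise to `C` gives `C` (its entries are `0, ±1`). [folklore] -/
private theorem cayleyMat_map :
    (Matrix.fromBlocks (1 : Matrix ι ι R) (1 : Matrix ι ι R) (1 : Matrix ι ι R) (-1 : Matrix ι ι R)).map σ =
      Matrix.fromBlocks (1 : Matrix ι ι R) (1 : Matrix ι ι R) (1 : Matrix ι ι R) (-1 : Matrix ι ι R) := by
  rw [Matrix.fromBlocks_map, Matrix.map_one σ (map_zero σ) (map_one σ)]
  congr 1
  ext i j
  simp only [Matrix.map_apply, Matrix.neg_apply, map_neg, Matrix.one_apply, apply_ite σ, map_one, map_zero]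

omit [Fintype ι] in
/-- `C` is symmetric. [folklore] -/
private theorem cayleyMat_transpose :
    (Matrix.fromBlocks (1 : Matrix ι ι R) (1 : Matrix ι ι R) (1 : Matrix ι ι R) (-1 : Matrix ι ι R))ᵀ =
      Matrix.fromBlocks (1 : Matrix ι ι R) (1 : Matrix ι ι R) (1 : Matrix ι ι R) (-1 : Matrix ι ι R) := by
  rw [Matrix.fromBlocks_transpose, Matrix.transpose_one, Matrix.transpose_neg, Matrix.transpose_one]

/-- **The doubled form in the Cayley basis is anti-diagonal**: `σ(C)ᵀ (S ⊕ −S) C = antidiag(S + S, S + S)` — the ring-level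
form of `DoubledUnitary.formCongr_cayley_diagForm`. [cite: HarrisKudlaSweet1996, §1 (1.11)] -/
theorem formCongr_cayleyMat (S : Matrix ι ι R) :
    ((Matrix.fromBlocks (1 : Matrix ι ι R) (1 : Matrix ι ι R) (1 : Matrix ι ι R) (-1 : Matrix ι ι R)).map σ)ᵀ *
        Matrix.fromBlocks S 0 0 (-S) *
        Matrix.fromBlocks (1 : Matrix ι ι R) (1 : Matrix ι ι R) (1 : Matrix ι ι R) (-1 : Matrix ι ι R) =
      Matrix.fromBlocks 0 (S + S) (S + S) 0 := by
  rw [cayleyMat_map, cayleyMat_transpose, cayleyMat_mul_mul_cayleyMat]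
  congr 1 <;> abel

/-! ### the unipotent elements `n(z) = [[1, z], [0, 1]]` of `U(σ, antidiag(τ, τ))` -/

/-- `n(z) n(z') = n(z + z')` at the matrix level. [folklore] -/
private theorem unipMat_mul (z z' : Matrix ι ι R) :
    Matrix.fromBlocks (1 : Matrix ι ι R) z 0 (1 : Matrix ι ι R) * Matrix.fromBlocks (1 : Matrix ι ι R) z' 0 (1 : Matrix ι ι R) =
      Matrix.fromBlocks 1 (z + z') 0 1 := by
  simp only [Matrix.fromBlocks_multiply, Matrix.one_mul, Matrix.mul_one, Matrix.zero_mul, Matrix.mul_zero, add_zero,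
    zero_add]
  congr 1
  exact add_comm _ _

/-- the defining equation of `U(σ, antidiag(τ, τ))` evaluated on `n(z)`: `σ(n(z))ᵀ J n(z) = [[0, τ], [τ, τ z + σ(z)ᵀ τ]]`.
[folklore] -/
private theorem unipMat_form (τ z : Matrix ι ι R) :
    ((Matrix.fromBlocks (1 : Matrix ι ι R) z 0 (1 : Matrix ι ι R)).map σ)ᵀ * Matrix.fromBlocks 0 τ τ 0 *
        Matrix.fromBlocks (1 : Matrix ι ι R) z 0 (1 : Matrix ι ι R) =
      Matrix.fromBlocks 0 τ τ (τ * z + (z.map σ)ᵀ * τ) := by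
  rw [Matrix.fromBlocks_map, Matrix.map_one σ (map_zero σ) (map_one σ), Matrix.map_zero σ (map_zero σ),
    Matrix.fromBlocks_transpose, Matrix.transpose_one, Matrix.transpose_zero]
  simp only [Matrix.fromBlocks_multiply, Matrix.one_mul, Matrix.mul_one, Matrix.zero_mul, Matrix.mul_zero, add_zero,
    zero_add]

/-- **The unipotent radical of the Siegel parabolic, ring level.**  There is a map `n : Matrix ι ι R → GL_{ι ⊕ ι}(R)`
with `n(z) = [[1, z], [0, 1]]`, additive-to-multiplicative (`n(z + z') = n(z) n(z')`), and
`n(z) ∈ U(σ, antidiag(τ, τ)) ↔ τ z + σ(z)ᵀ τ = 0` (`N ≅` the `τ`-skew-hermitian matrices).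
[cite: HarrisKudlaSweet1996, §1 (1.11)–(1.12)] -/
theorem exists_unipotent (τ : Matrix ι ι R) :
    ∃ n : Matrix ι ι R → GL (ι ⊕ ι) R,
      (∀ z, ((n z : GL (ι ⊕ ι) R) : Matrix (ι ⊕ ι) (ι ⊕ ι) R) = Matrix.fromBlocks 1 z 0 1) ∧
      (∀ z z', n (z + z') = n z * n z') ∧
      ∀ z, n z ∈ unitaryGroupOfForm σ (Matrix.fromBlocks 0 τ τ 0) ↔ τ * z + (z.map σ)ᵀ * τ = 0 := by
  refine ⟨fun z => ⟨Matrix.fromBlocks 1 z 0 1, Matrix.fromBlocks 1 (-z) 0 1, ?_, ?_⟩, fun z => rfl, fun z z' => ?_,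
    fun z => ?_⟩
  · rw [unipMat_mul, add_neg_cancel, Matrix.fromBlocks_one]
  · rw [unipMat_mul, neg_add_cancel, Matrix.fromBlocks_one]
  · exact Units.ext (unipMat_mul z z').symm
  · rw [mem_unitaryGroupOfForm_iff]
    change ((Matrix.fromBlocks (1 : Matrix ι ι R) z 0 (1 : Matrix ι ι R)).map σ)ᵀ * Matrix.fromBlocks 0 τ τ 0 *
      Matrix.fromBlocks (1 : Matrix ι ι R) z 0 (1 : Matrix ι ι R) = Matrix.fromBlocks 0 τ τ 0 ↔ _
    rw [unipMat_form, Matrix.fromBlocks_inj]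
    simp only [true_and]


/-! ### the Levi elements `m(α) = diag(α, τ⁻¹ σ(α⁻¹)ᵀ τ)` of `U(σ, antidiag(τ, τ))` -/

/-- `σ(τ⁻¹) = τ⁻¹` for `σ`-fixed invertible `τ`. [folklore] -/
private theorem map_nonsing_inv_of_map_eq {τ : Matrix ι ι R} (hτσ : τ.map σ = τ) (hτu : IsUnit τ.det) :
    τ⁻¹.map σ = τ⁻¹ := by
  symm
  refine Matrix.inv_eq_left_inv ?_
  calc τ⁻¹.map σ * τ = τ⁻¹.map σ * τ.map σ := by rw [hτσ]
    _ = (τ⁻¹ * τ).map σ := (Matrix.map_mul).symm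
    _ = 1 := by rw [Matrix.nonsing_inv_mul τ hτu, Matrix.map_one σ (map_zero σ) (map_one σ)]

/-- **The Levi factor of the Siegel parabolic, ring level.**  For `σ` an involution and `τ` symmetric, `σ`-fixed, with
unit determinant there is a homomorphism `m : GL_ι(R) →* GL_{ι ⊕ ι}(R)`, `m(α) = diag(α, τ⁻¹ σ(α⁻¹)ᵀ τ)`, with values in
`U(σ, antidiag(τ, τ))` (`M ≅ GL_ι(R)`; over a field the tree's `DoubledUnitary.leviUpper`).
[cite: HarrisKudlaSweet1996, §1 (1.11)–(1.12)] -/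
theorem exists_leviHom (hσ : ∀ x, σ (σ x) = x) {τ : Matrix ι ι R} (hτσ : τ.map σ = τ) (hτs : τᵀ = τ)
    (hτu : IsUnit τ.det) :
    ∃ m : GL ι R →* GL (ι ⊕ ι) R,
      (∀ α, ((m α : GL (ι ⊕ ι) R) : Matrix (ι ⊕ ι) (ι ⊕ ι) R) =
        Matrix.fromBlocks (α : Matrix ι ι R) 0 0 (τ⁻¹ * (((α⁻¹ : GL ι R) : Matrix ι ι R).map σ)ᵀ * τ)) ∧
      ∀ α, m α ∈ unitaryGroupOfForm σ (Matrix.fromBlocks 0 τ τ 0) := by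
  set F : GL ι R → Matrix (ι ⊕ ι) (ι ⊕ ι) R := fun α =>
    Matrix.fromBlocks (α : Matrix ι ι R) 0 0 (τ⁻¹ * (((α⁻¹ : GL ι R) : Matrix ι ι R).map σ)ᵀ * τ) with hF
  have hττ : τ * τ⁻¹ = 1 := Matrix.mul_nonsing_inv τ hτu
  have hττ' : τ⁻¹ * τ = 1 := Matrix.nonsing_inv_mul τ hτu
  have hF_one : F 1 = 1 := by
    simp only [hF, inv_one, Units.val_one, Matrix.map_one σ (map_zero σ) (map_one σ), Matrix.transpose_one,
      Matrix.mul_one, hττ', Matrix.fromBlocks_one]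
  have hF_mul : ∀ α α' : GL ι R, F (α * α') = F α * F α' := by
    intro α α'
    simp only [hF, Matrix.fromBlocks_multiply, Matrix.zero_mul, Matrix.mul_zero, add_zero, zero_add, Units.val_mul,
      _root_.mul_inv_rev, Matrix.map_mul, Matrix.transpose_mul]
    congr 1
    calc τ⁻¹ * ((((α⁻¹ : GL ι R) : Matrix ι ι R).map σ)ᵀ * (((α'⁻¹ : GL ι R) : Matrix ι ι R).map σ)ᵀ) * τ
        = τ⁻¹ * (((α⁻¹ : GL ι R) : Matrix ι ι R).map σ)ᵀ * (τ * τ⁻¹) *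
            (((α'⁻¹ : GL ι R) : Matrix ι ι R).map σ)ᵀ * τ := by
          rw [hττ, Matrix.mul_one]; simp only [Matrix.mul_assoc]
      _ = τ⁻¹ * (((α⁻¹ : GL ι R) : Matrix ι ι R).map σ)ᵀ * τ *
            (τ⁻¹ * (((α'⁻¹ : GL ι R) : Matrix ι ι R).map σ)ᵀ * τ) := by simp only [Matrix.mul_assoc]
  refine ⟨{ toFun := fun α => ⟨F α, F α⁻¹, ?_, ?_⟩, map_one' := ?_, map_mul' := ?_ }, fun α => rfl, fun α => ?_⟩
  · rw [← hF_mul, mul_inv_cancel, hF_one]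
  · rw [← hF_mul, inv_mul_cancel, hF_one]
  · exact Units.ext hF_one
  · intro α α'; exact Units.ext (hF_mul α α')
  · -- membership in `U(σ, antidiag(τ, τ))`
    rw [mem_unitaryGroupOfForm_iff]
    change ((F α).map σ)ᵀ * Matrix.fromBlocks 0 τ τ 0 * F α = Matrix.fromBlocks 0 τ τ 0
    have hαα : (((α⁻¹ : GL ι R) : Matrix ι ι R)) * (α : Matrix ι ι R) = 1 := by
      rw [← Units.val_mul, inv_mul_cancel, Units.val_one]
    have hD : (τ⁻¹ * (((α⁻¹ : GL ι R) : Matrix ι ι R).map σ)ᵀ * τ).map σ = τ⁻¹ * ((α⁻¹ : GL ι R) : Matrix ι ι R)ᵀ * τ := by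
      rw [Matrix.map_mul, Matrix.map_mul, map_nonsing_inv_of_map_eq σ hτσ hτu, hτσ, ← Matrix.transpose_map,
        Matrix.map_map]
      have hid : (σ ∘ σ : R → R) = id := funext hσ
      rw [hid, Matrix.map_id]
    have hDt : (τ⁻¹ * ((α⁻¹ : GL ι R) : Matrix ι ι R)ᵀ * τ)ᵀ = τ * ((α⁻¹ : GL ι R) : Matrix ι ι R) * τ⁻¹ := by
      rw [Matrix.transpose_mul, Matrix.transpose_mul, Matrix.transpose_transpose, Matrix.transpose_nonsing_inv, hτs,
        Matrix.mul_assoc]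
    simp only [hF, Matrix.fromBlocks_map, Matrix.map_zero σ (map_zero σ), hD, Matrix.fromBlocks_transpose,
      Matrix.transpose_zero, hDt, Matrix.fromBlocks_multiply, Matrix.zero_mul, Matrix.mul_zero, add_zero, zero_add]
    congr 1
    · -- `(σα)ᵀ τ (τ⁻¹ (σα⁻¹)ᵀ τ) = τ`
      calc ((α : Matrix ι ι R).map σ)ᵀ * τ * (τ⁻¹ * (((α⁻¹ : GL ι R) : Matrix ι ι R).map σ)ᵀ * τ)
          = ((α : Matrix ι ι R).map σ)ᵀ * (τ * τ⁻¹) * (((α⁻¹ : GL ι R) : Matrix ι ι R).map σ)ᵀ * τ := by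
            simp only [Matrix.mul_assoc]
        _ = ((((α⁻¹ : GL ι R) : Matrix ι ι R) * (α : Matrix ι ι R)).map σ)ᵀ * τ := by
            rw [hττ, Matrix.mul_one, Matrix.map_mul, Matrix.transpose_mul]
        _ = τ := by rw [hαα, Matrix.map_one σ (map_zero σ) (map_one σ), Matrix.transpose_one, Matrix.one_mul]
    · -- `(τ α⁻¹ τ⁻¹) τ α = τ`
      calc τ * ((α⁻¹ : GL ι R) : Matrix ι ι R) * τ⁻¹ * τ * (α : Matrix ι ι R)
          = τ * (((α⁻¹ : GL ι R) : Matrix ι ι R) * ((τ⁻¹ * τ) * (α : Matrix ι ι R))) := by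
            simp only [Matrix.mul_assoc]
        _ = τ := by rw [hττ', Matrix.one_mul, hαα, Matrix.mul_one]


end Literature.NumberTheory.Automorphic.DoubledUnitary
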